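import Summits.Ventures.PackingBounds.Energy.NewtonCertificate

/-!
# Universal optimality of the regular icosahedron (12 points on S²) — Cohn–Kumar 2007, Thm. 1.2, in
LP-certificate form

Framing: lottery ticket; floor = certified bounds/negative ranges. Venture `PackingBounds` (cell
`pub-packcert`, seat `pub-packcert-energy`), energy-minimisation family, **universal + control**
(the one sharp configuration of Cohn–Kumar's Table 1 with irrational inner products, `±1/√5`).

**Theorem A (`ckPow_energy_ge`, every `k : ℕ`).** Every configuration `C` of `12` unit vectors of
`ℝ³` satisfies `Σ_{x ≠ y ∈ C} (1 + ⟨x,y⟩)^k ≥ 12 · ((1 - 1)^k + 5 (1 - 1/√5)^k + 5 (1 + 1/√5)^k)`,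
the `(1+t)^k`-energy (ordered pairs) of the regular icosahedron (inner products `-1, -1/√5, 1/√5`
with multiplicities `1, 5, 5` from each vertex; a spherical `5`-design).

**Theorem B (`universally_optimal`).** For every potential `a` represented on `[-1,1)` by `a(s) =
Σ_k c_k (1+s)^k`, `c_k ≥ 0` (≡ absolutely monotonic on `[-1,1)` by S. Bernstein's theorem; e.g. all
inverse power laws, so this contains the Thomson-problem answer for `N = 12` of Andreev 1996 as the
case `a(t) = (2-2t)^(-1/2)`), every such `C` has `Σ_{x ≠ y ∈ C} a(⟨x,y⟩) ≥ 12 (a(-1) + 5 a(-1/√5) +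
5 a(1/√5))`, the `a`-energy of the icosahedron.

Certificate over `ℚ(√5)` (kernel-checked): node values `u = 1 + t ∈ (0, 1 - √5/5, 1 + √5/5)` doubled
(`D = 6`), the Legendre (`C^(1/2)`) expansion table `G` of the six Newton partial products with
entries `a + b√5 ≥ 0` (decided with `2.236 < √5 < 2.2361`), the six design identities; every
polynomial identity is closed by `linear_combination e · (√5² = 5)` with an explicit multiplier `e`
computed by the cell's `code/emit_icosa_universal.py` (exact `ℚ(√5)` arithmetic), then
`NewtonCert.energy_ge` / `energy_ge_hasSum_of_pow`.

## References
* H. Cohn, A. Kumar, *Universally optimal distribution of points on spheres*, J. Amer. Math. Soc.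
  20 (2007) 99–148, Thm. 1.2, Table 1, §§5–6. [`CohnKumar2006`]
* N. N. Andreev, *An extremal property of the icosahedron*, East J. Approx. 2 (1996) 459–462.
-/

noncomputable section

namespace Summit.Ventures.PackingBounds.Energy

open Finset Literature.Analysis.SpecialFunctions Literature.Geometry.DiscreteGeometry

namespace UniversalIcosahedron

/-- Explicit form of the Gegenbauer polynomial `C_0^(1 / 2)` of the tree. [folklore] -/
private theorem c1_2_0 (t : ℝ) : gegenbauerSum (1 / 2 : ℝ) 0 t =
    (1 : ℝ) := by
  simp [gegenbauerSum, gegenbauerCoeff]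

/-- Explicit form of the Gegenbauer polynomial `C_1^(1 / 2)` of the tree. [folklore] -/
private theorem c1_2_1 (t : ℝ) : gegenbauerSum (1 / 2 : ℝ) 1 t =
    (1 : ℝ) * t := by
  rw [gegenbauerSum_one]
  ring

/-- Explicit form of the Gegenbauer polynomial `C_2^(1 / 2)` of the tree. [folklore] -/
private theorem c1_2_2 (t : ℝ) : gegenbauerSum (1 / 2 : ℝ) 2 t =
    (-1 / 2 : ℝ) + (3 / 2 : ℝ) * t ^ 2 := by
  simp [gegenbauerSum, gegenbauerCoeff, Finset.sum_range_succ, Finset.prod_range_succ,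
    Nat.factorial]
  ring

/-- Explicit form of the Gegenbauer polynomial `C_3^(1 / 2)` of the tree. [folklore] -/
private theorem c1_2_3 (t : ℝ) : gegenbauerSum (1 / 2 : ℝ) 3 t =
    (-3 / 2 : ℝ) * t + (5 / 2 : ℝ) * t ^ 3 := by
  simp [gegenbauerSum, gegenbauerCoeff, Finset.sum_range_succ, Finset.prod_range_succ,
    Nat.factorial]
  ring

/-- Explicit form of the Gegenbauer polynomial `C_4^(1 / 2)` of the tree. [folklore] -/
private theorem c1_2_4 (t : ℝ) : gegenbauerSum (1 / 2 : ℝ) 4 t =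
    (3 / 8 : ℝ) + (-15 / 4 : ℝ) * t ^ 2 + (35 / 8 : ℝ) * t ^ 4 := by
  simp [gegenbauerSum, gegenbauerCoeff, Finset.sum_range_succ, Finset.prod_range_succ,
    Nat.factorial]
  ring

/-- Explicit form of the Gegenbauer polynomial `C_5^(1 / 2)` of the tree. [folklore] -/
private theorem c1_2_5 (t : ℝ) : gegenbauerSum (1 / 2 : ℝ) 5 t =
    (15 / 8 : ℝ) * t + (-35 / 4 : ℝ) * t ^ 3 + (63 / 8 : ℝ) * t ^ 5 := by
  simp [gegenbauerSum, gegenbauerCoeff, Finset.sum_range_succ, Finset.prod_range_succ,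
    Nat.factorial]
  ring

/-- `2.236 < √5 < 2.2361` and `(√5)² = 5`. [folklore] -/
private theorem sqrt5_facts :
    Real.sqrt 5 ^ 2 = 5 ∧ (2236 / 1000 : ℝ) < Real.sqrt 5 ∧ Real.sqrt 5 < 22361 / 10000 := by
  refine ⟨Real.sq_sqrt (by norm_num), ?_, ?_⟩
  · rw [show (2236 / 1000 : ℝ) = Real.sqrt ((2236 / 1000) ^ 2) by
      rw [Real.sqrt_sq (by norm_num)]]
    exact Real.sqrt_lt_sqrt (by norm_num) (by norm_num)
  · rw [show (22361 / 10000 : ℝ) = Real.sqrt ((22361 / 10000) ^ 2) by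
      rw [Real.sqrt_sq (by norm_num)]]
    exact Real.sqrt_lt_sqrt (by norm_num) (by norm_num)

open scoped Classical in
/-- **Theorem A.** For every `k`, every `12`-point configuration of unit vectors in `ℝ³` has `Σ_{x ≠
y} (1 + ⟨x,y⟩)^k ≥ 12 ((1 + (-1))^k + 5 (1 - √5/5)^k + 5 (1 + √5/5)^k)`, the value of the regular
icosahedron. Newton-form certificate over `ℚ(√5)`. [cite: CohnKumar2006, Theorem 1.2, Table 1 and
§6] -/
theorem ckPow_energy_ge (k : ℕ) (C : Finset (EuclideanSpace ℝ (Fin 3)))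
    (h1 : ∀ x ∈ C, ‖x‖ = 1) (hN : C.card = 12) :
    (12 : ℝ) * ((1 + (-1 : ℝ)) ^ k + 5 * (1 + (-(Real.sqrt 5 / 5))) ^ k
        + 5 * (1 + Real.sqrt 5 / 5) ^ k) ≤
      ∑ x ∈ C, ∑ y ∈ C.erase x, (1 + inner ℝ x y) ^ k := by
  obtain ⟨h5, hlo, hhi⟩ := sqrt5_facts
  refine le_trans (le_of_eq ?val) (NewtonCert.energy_ge (n := 3) (μ := 1 / 2) (by norm_num)
    (by norm_num) 6 (by norm_num)
    -- node values u_i = 1 + t_i (doubled sequence)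
    (fun i : ℕ => match i with
      | 0 => (0 : ℝ) | 1 => 1 - Real.sqrt 5 / 5 | 2 => 1 + Real.sqrt 5 / 5 | 3 => 0
      | 4 => 1 - Real.sqrt 5 / 5 | 5 => 1 + Real.sqrt 5 / 5 | _ => 0)
    ?hv ?hsq
    -- Legendre expansion table of the 6 Newton partial products (row j, column i), entries in ℚ(√5)
    (fun j i : ℕ => match j with
      | 0 => (match i with
          | 0 => (1 : ℝ) | _ => 0)
      | 1 => (match i with
          | 0 => (1 : ℝ) | 1 => (1 : ℝ) | _ => 0)
      | 2 => (match i with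
          | 0 => (1 / 3 : ℝ) + (1 / 5 : ℝ) * Real.sqrt 5
          | 1 => (1 : ℝ) + (1 / 5 : ℝ) * Real.sqrt 5 | 2 => (2 / 3 : ℝ) | _ => 0)
      | 3 => (match i with
          | 0 => (2 / 15 : ℝ) | 1 => (2 / 5 : ℝ) | 2 => (2 / 3 : ℝ) | 3 => (2 / 5 : ℝ) | _ => 0)
      | 4 => (match i with
          | 0 => (4 / 15 : ℝ) | 1 => (4 / 5 : ℝ) | 2 => (116 / 105 : ℝ) | 3 => (4 / 5 : ℝ)
          | 4 => (8 / 35 : ℝ) | _ => 0)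
      | 5 => (match i with
          | 0 => (4 / 15 : ℝ) + (4 / 75 : ℝ) * Real.sqrt 5
          | 1 => (124 / 175 : ℝ) + (4 / 25 : ℝ) * Real.sqrt 5
          | 2 => (92 / 105 : ℝ) + (116 / 525 : ℝ) * Real.sqrt 5
          | 3 => (172 / 225 : ℝ) + (4 / 25 : ℝ) * Real.sqrt 5
          | 4 => (16 / 35 : ℝ) + (8 / 175 : ℝ) * Real.sqrt 5 | 5 => (8 / 63 : ℝ) | _ => 0)
      | _ => 0)
    ?hG ?hGid 12 3 (by norm_num)
    -- distance distribution m_i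
    (fun i : ℕ => match i with | 0 => (1 : ℝ) | 1 => 5 | 2 => 5 | _ => 0)
    ?hdes k C h1 hN)
  case hv => intro i; split <;> nlinarith [hlo, hhi]
  case hsq =>
    exact fun u _ => NewtonCert.omega_doubled_nonneg _ 3 (fun i hi => by
      interval_cases i <;> norm_num) u
  case hG =>
    intro j i
    split <;> (first | (split <;> nlinarith [hlo, hhi]) | norm_num)
  case hGid =>
    intro j hj t
    interval_cases j
    · simp only [Finset.prod_range_zero, Finset.sum_range_succ, Finset.sum_range_zero, c1_2_0, c1_2_1, c1_2_2, c1_2_3, c1_2_4, c1_2_5]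
      linear_combination ((0 : ℝ)) * h5
    · simp only [Finset.prod_range_succ, Finset.prod_range_zero, Finset.sum_range_succ,
        Finset.sum_range_zero, c1_2_0, c1_2_1, c1_2_2, c1_2_3, c1_2_4, c1_2_5]
      linear_combination ((0 : ℝ)) * h5
    · simp only [Finset.prod_range_succ, Finset.prod_range_zero, Finset.sum_range_succ,
        Finset.sum_range_zero, c1_2_0, c1_2_1, c1_2_2, c1_2_3, c1_2_4, c1_2_5]
      linear_combination ((0 : ℝ)) * h5
    · simp only [Finset.prod_range_succ, Finset.prod_range_zero, Finset.sum_range_succ,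
        Finset.sum_range_zero, c1_2_0, c1_2_1, c1_2_2, c1_2_3, c1_2_4, c1_2_5]
      linear_combination ((-1 / 25 : ℝ) + (-1 / 25 : ℝ) * t) * h5
    · simp only [Finset.prod_range_succ, Finset.prod_range_zero, Finset.sum_range_succ,
        Finset.sum_range_zero, c1_2_0, c1_2_1, c1_2_2, c1_2_3, c1_2_4, c1_2_5]
      linear_combination ((-1 / 25 : ℝ) + (-2 / 25 : ℝ) * t + (-1 / 25 : ℝ) * t ^ 2) * h5
    · simp only [Finset.prod_range_succ, Finset.prod_range_zero, Finset.sum_range_succ,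
        Finset.sum_range_zero, c1_2_0, c1_2_1, c1_2_2, c1_2_3, c1_2_4, c1_2_5]
      linear_combination ((-1 / 25 : ℝ) * t + (-2 / 25 : ℝ) * t ^ 2 + (-1 / 25 : ℝ) * t ^ 3 + (-1 / 125 : ℝ) * Real.sqrt 5 + (-2 / 125 : ℝ) * Real.sqrt 5 * t + (-1 / 125 : ℝ) * Real.sqrt 5 * t ^ 2) * h5
  case hdes =>
    intro j hj
    interval_cases j
    · simp only [Finset.prod_range_zero, Finset.sum_range_succ, Finset.sum_range_zero]
      push_cast
      linear_combination ((0 : ℝ)) * h5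
    · simp only [Finset.prod_range_succ, Finset.prod_range_zero, Finset.sum_range_succ,
        Finset.sum_range_zero]
      push_cast
      linear_combination ((0 : ℝ)) * h5
    · simp only [Finset.prod_range_succ, Finset.prod_range_zero, Finset.sum_range_succ,
        Finset.sum_range_zero]
      push_cast
      linear_combination ((-2 / 5 : ℝ)) * h5
    · simp only [Finset.prod_range_succ, Finset.prod_range_zero, Finset.sum_range_succ,
        Finset.sum_range_zero]
      push_cast
      linear_combination ((2 / 25 : ℝ)) * h5
    · simp only [Finset.prod_range_succ, Finset.prod_range_zero, Finset.sum_range_succ,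
        Finset.sum_range_zero]
      push_cast
      linear_combination ((4 / 25 : ℝ)) * h5
    · simp only [Finset.prod_range_succ, Finset.prod_range_zero, Finset.sum_range_succ,
        Finset.sum_range_zero]
      push_cast
      linear_combination ((4 / 25 : ℝ) + (4 / 125 : ℝ) * Real.sqrt 5) * h5
  case val =>
    simp only [Finset.sum_range_succ, Finset.sum_range_zero]
    push_cast
    ring

open scoped Classical in
/-- **Theorem B (universal optimality of the icosahedron, Cohn–Kumar Thm. 1.2).** For every
potential `a` with `a(s) = Σ_k c_k (1+s)^k`, `c_k ≥ 0`, on `[-1,1)` (≡ absolutely monotonic on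
`[-1,1)` by Bernstein's theorem), every `12`-point configuration of unit vectors in `ℝ³` has `Σ_{x ≠
y} a(⟨x,y⟩) ≥ 12 (a(-1) + 5 a(-√5/5) + 5 a(√5/5))`, the `a`-energy of the regular icosahedron.
[cite: CohnKumar2006, Theorem 1.2] -/
theorem universally_optimal (a : ℝ → ℝ) (c : ℕ → ℝ) (hc : ∀ k, 0 ≤ c k)
    (ha : ∀ s : ℝ, -1 ≤ s → s < 1 → HasSum (fun k => c k * (1 + s) ^ k) (a s))
    (C : Finset (EuclideanSpace ℝ (Fin 3))) (h1 : ∀ x ∈ C, ‖x‖ = 1) (hN : C.card = 12) :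
    (12 : ℝ) * (a (-1) + 5 * a (-(Real.sqrt 5 / 5)) + 5 * a (Real.sqrt 5 / 5)) ≤
      ∑ x ∈ C, ∑ y ∈ C.erase x, a (inner ℝ x y) := by
  obtain ⟨_, hlo, hhi⟩ := sqrt5_facts
  have key := NewtonCert.energy_ge_hasSum_of_pow (n := 3) 12 3
    (fun i : ℕ => match i with | 0 => (-1 : ℝ) | 1 => -(Real.sqrt 5 / 5) | 2 => Real.sqrt 5 / 5 | _ => 0)
    (fun i : ℕ => match i with | 0 => (1 : ℝ) | 1 => 5 | 2 => 5 | _ => 0)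
    (fun i hi => by interval_cases i <;> constructor <;> norm_num <;> nlinarith [hlo, hhi]) C h1
    (fun k => by
      have h := ckPow_energy_ge k C h1 hN
      simp only [Finset.sum_range_succ, Finset.sum_range_zero] at h ⊢
      push_cast at h ⊢
      linarith)
    a c hc ha
  simp only [Finset.sum_range_succ, Finset.sum_range_zero] at key
  push_cast at key
  linarith

end UniversalIcosahedron

end Summit.Ventures.PackingBounds.Energy

end

-- build-artefact refresh 2026-08-23 (ops-buildfix-3 gen 18, incident B18-1): comment-only touch so that lake
-- rebuilds this module, whose hub/root `.olean` was page-truncated by the ENOSPC event; no declaration changed.
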